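import Literature.Barriers.CriticalPhenomena.TimarBoxesGood
import HarnessLib

/-!
# Timár 2006, proof of Thm. 4.3: the mass process — support, bounds, the population recursion,
# and "the tree is infinite ⟹ `C(o)` is infinite" (deterministic part), PROVED

Barrier catalogue `Literature/Barriers/CriticalPhenomena/`; continues `TimarBoxes.lean`,
`TimarBoxesGood.lean` towards `Timar2006_noInfiniteLightClusters_holds`. Á. Timár, Ann. Probab.
34 (2006) 2344–2364, proof of Thm. 4.3 (pp. 2354–2356) and of Lemma 4.1 (p. 2352). The
generations `O_g` of the random tree `T` are the supports of the masses `timarMass … g`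
(`TimarBoxes.lean`); proved here, for every configuration `ω`:

* `mem_of_timarMass_ne_zero` — `O_g ⊆ G(ℓ_{g(n+2)+1}, ℓ_{g(n+2)}] ∩ C(o) ∩ B(o, gρ)` ("the `g`th
  generation `O_g` of `T` using vertices in `G(ℓ_{gi+1}, ℓ_{gi}]`"; "the corresponding vertices
  in `G` all belong to one (infinite) open cluster", pp. 2354–2356);
* `timarMass_le_pow` — `m_g ≤ a^{-g}` when `θ ≤ a⁻¹` (a child has ONE parent, by the
  disjointness of the children of distinct parents, `timarChildren_disjoint`);
* `timarPop_succ` — `Y_{g+1} = Σ_x m_g(x) θ_g(x) · #children(x)` (the offspring of generation `g`),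
  `timarPop_zero` (`Y_0 = 1`), `timarPop_ne_zero_of_succ` (extinction is for ever);
* `infinite_openCluster_of_timarPop_ne_zero` — "The nonextinction of `T` means that the
  corresponding vertices in `G` all belong to one (infinite) open cluster" (p. 2356): if every
  `Y_g ≠ 0` then `C(o)` meets every slab `g(n+2)`, hence is infinite.

## References

* Á. Timár, Ann. Probab. 34 (2006) 2344–2364 (arXiv:math/0702875), §4, proofs of Lemma 4.1
  and Thm. 4.3. [Timar2006]
-/

noncomputable section

namespace Literature.Barriers.CriticalPhenomena

open Literature.Probability.Percolation
open scoped _root_.ENNReal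

variable {V : Type*}

section Process

variable {G : SimpleGraph V} [G.LocallyFinite] {o : V} {n ρ : ℕ} {θ : ℕ → V → ℝ≥0∞}

/-- A vertex of positive mass in generation `g + 1` is a child of a vertex of positive mass in
generation `g`. [cite: Timar2006, §4 (proof of Thm. 4.3: O_{g+1} is made of the children of O_g)] -/
theorem exists_parent_of_timarMass_succ_ne_zero {ω : BondConfig V} {g : ℕ} {c : V}
    (h : timarMass G o n ρ θ ω (g + 1) c ≠ 0) :
    ∃ x : V, timarMass G o n ρ θ ω g x ≠ 0 ∧ c ∈ timarChildren G o (g * (n + 2)) n ρ x ω := by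
  rw [timarMass_succ] at h
  obtain ⟨x, hx⟩ : ∃ x, timarMass G o n ρ θ ω g x * θ g x *
      (timarChildren G o (g * (n + 2)) n ρ x ω).indicator 1 c ≠ 0 := by
    by_contra hall
    push Not at hall
    exact h (ENNReal.tsum_eq_zero.2 hall)
  refine ⟨x, fun h0 => hx (by rw [h0, zero_mul, zero_mul]), ?_⟩
  by_contra hc
  exact hx (by rw [Set.indicator_of_notMem hc, mul_zero])

variable (hconn : G.Connected) (htr : IsGraphTransitive G) (hU : ¬ IsGraphUnimodular G)
include hconn htr hU

/-- **The support of generation `g`**: a vertex of positive mass in generation `g` lies in the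
slab `g (n + 2)`, in the open cluster of `o`, and in the ball `B(o, g ρ)`.
[cite: Timar2006, §4 (proof of Thm. 4.3: O_g ⊆ G(ℓ_{gi+1}, ℓ_{gi}]; the vertices of T lie in C(o))] -/
theorem mem_of_timarMass_ne_zero (ω : BondConfig V) :
    ∀ (g : ℕ) {c : V}, timarMass G o n ρ θ ω g c ≠ 0 →
      c ∈ slab G o (g * (n + 2)) ∧ c ∈ openCluster ω o ∧ c ∈ graphBall G o (g * ρ)
  | 0, c, h => by
    rw [timarMass_zero] at h
    have hc : c = o := by
      by_contra hc
      exact h (Set.indicator_of_notMem (by simpa using hc) _)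
    subst hc
    exact ⟨by simpa using mem_slab_zero hconn htr hU c, mem_openCluster_self ω c,
      by simpa using mem_graphBall_self G c 0⟩
  | g + 1, c, h => by
    obtain ⟨x, hx, hc⟩ := exists_parent_of_timarMass_succ_ne_zero h
    obtain ⟨hxs, hxC, hxB⟩ := mem_of_timarMass_ne_zero ω g hx
    refine ⟨?_, ?_, ?_⟩
    · have := timarChildren_subset_slab _ _ _ _ _ hc
      rwa [show g * (n + 2) + n + 2 = (g + 1) * (n + 2) by ring] at this
    · -- `c ∈ C(x) = C(o)`
      have hcx : c ∈ openCluster ω x := timarChildren_subset_openCluster _ _ _ _ _ hc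
      exact SimpleGraph.Reachable.trans hxC hcx
    · obtain ⟨w₁, hw₁⟩ := hxB
      obtain ⟨w₂, hw₂⟩ := timarChildren_subset_graphBall _ _ _ _ _ hc
      exact ⟨w₁.append w₂, by rw [SimpleGraph.Walk.length_append]; nlinarith⟩

omit hconn htr hU in
/-- At most one vertex of a generation has a given child: the `x`-sum of the child indicators is
at most `1`. [cite: Timar2006, §4 (proof of Thm. 4.3: good components of distinct vertices are disjoint)] -/
theorem tsum_indicator_timarChildren_le_one (hconn : G.Connected) (htr : IsGraphTransitive G)
    (hU : ¬ IsGraphUnimodular G) (b n ρ : ℕ) (ω : BondConfig V) (c : V) :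
    ∑' x, (timarChildren G o b n ρ x ω).indicator (1 : V → ℝ≥0∞) c ≤ 1 := by
  by_cases hex : ∃ x, c ∈ timarChildren G o b n ρ x ω
  · obtain ⟨x, hx⟩ := hex
    rw [tsum_eq_single x]
    · rw [Set.indicator_of_mem hx]; exact le_rfl
    · intro y hyx
      refine Set.indicator_of_notMem (fun hy => ?_) _
      exact Set.disjoint_left.1 (timarChildren_disjoint hconn htr hU n ρ hyx ω) hy hx
  · push Not at hex
    rw [ENNReal.tsum_eq_zero.2 fun x => Set.indicator_of_notMem (hex x) _]
    exact zero_le_one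

/-- **Masses decay geometrically**: if `θ_g(x) ≤ a⁻¹` throughout then `m_g ≤ a^{-g}` (a child
inherits `m · θ` from its unique parent). [cite: Timar2006, §4 (proof of Lemma 4.1: Y_m = |O_m|/(pk)^m)] -/
theorem timarMass_le_pow {a : ℝ≥0∞} (hθ : ∀ g x, θ g x ≤ a⁻¹) (ω : BondConfig V) :
    ∀ (g : ℕ) (c : V), timarMass G o n ρ θ ω g c ≤ a⁻¹ ^ g
  | 0, c => by
    rw [timarMass_zero, pow_zero]
    exact Set.indicator_le_self' (fun _ _ => zero_le_one) c
  | g + 1, c => by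
    rw [timarMass_succ]
    calc ∑' x, timarMass G o n ρ θ ω g x * θ g x *
          (timarChildren G o (g * (n + 2)) n ρ x ω).indicator 1 c
        ≤ ∑' x, a⁻¹ ^ g * a⁻¹ * (timarChildren G o (g * (n + 2)) n ρ x ω).indicator 1 c := by
          refine ENNReal.tsum_le_tsum fun x => ?_
          gcongr
          · exact timarMass_le_pow hθ ω g x
          · exact hθ g x
      _ = a⁻¹ ^ (g + 1) * ∑' x, (timarChildren G o (g * (n + 2)) n ρ x ω).indicator 1 c := by
          rw [← ENNReal.tsum_mul_left, pow_succ]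
      _ ≤ a⁻¹ ^ (g + 1) * 1 := by
          gcongr; exact tsum_indicator_timarChildren_le_one hconn htr hU _ n ρ ω c
      _ = a⁻¹ ^ (g + 1) := mul_one _

omit hconn htr hU in
/-- **The population recursion**: `Y_{g+1} = Σ_x m_g(x) · θ_g(x) · #children(x)`.
[cite: Timar2006, §4 (proof of Lemma 4.1: X = X_1 + ⋯ + X_n, the offspring of generation m)] -/
theorem timarPop_succ (ω : BondConfig V) (g : ℕ) :
    timarPop G o n ρ θ ω (g + 1) = ∑' x, timarMass G o n ρ θ ω g x * θ g x *
      ((timarChildren G o (g * (n + 2)) n ρ x ω).encard : ℝ≥0∞) := by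
  rw [timarPop]
  simp only [timarMass_succ]
  rw [ENNReal.tsum_comm]
  refine tsum_congr fun x => ?_
  rw [ENNReal.tsum_mul_left]
  congr 1
  rw [show (1 : V → ℝ≥0∞) = fun _ => 1 from rfl, tsum_indicator_const, mul_one]

omit hconn htr hU in
/-- `Y_0 = 1`. [cite: Timar2006, §4 (proof of Lemma 4.1: O_0 = {o})] -/
theorem timarPop_zero (ω : BondConfig V) : timarPop G o n ρ θ ω 0 = 1 := by
  rw [timarPop, timarMass_zero, show (1 : V → ℝ≥0∞) = fun _ => 1 from rfl, tsum_indicator_const,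
    Set.encard_singleton]
  simp

omit hconn htr hU in
/-- A generation is empty iff its population vanishes: `Y_g ≠ 0 ↔ ∃ c, m_g(c) ≠ 0`. [folklore] -/
theorem timarPop_ne_zero_iff (ω : BondConfig V) (g : ℕ) :
    timarPop G o n ρ θ ω g ≠ 0 ↔ ∃ c, timarMass G o n ρ θ ω g c ≠ 0 := by
  rw [timarPop, Ne, ENNReal.tsum_eq_zero, not_forall]

omit hconn htr hU in
/-- **Extinction is for ever**: `Y_{g+1} ≠ 0 → Y_g ≠ 0`. [cite: Timar2006, §4 (proof of Lemma 4.1: the tree does not die out)] -/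
theorem timarPop_ne_zero_of_succ {ω : BondConfig V} {g : ℕ} (h : timarPop G o n ρ θ ω (g + 1) ≠ 0) :
    timarPop G o n ρ θ ω g ≠ 0 := by
  rw [timarPop_ne_zero_iff] at h ⊢
  obtain ⟨c, hc⟩ := h
  obtain ⟨x, hx, -⟩ := exists_parent_of_timarMass_succ_ne_zero hc
  exact ⟨x, hx⟩

/-- **"The nonextinction of `T` means that the corresponding vertices in `G` all belong to one
(infinite) open cluster"** (p. 2356): if no generation is empty then `C(o)` meets every slab
`g (n + 2)`, `g ∈ ℕ`, and is therefore infinite.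
[cite: Timar2006, §4 (proof of Thm. 4.3, last paragraph)] -/
theorem infinite_openCluster_of_timarPop_ne_zero {ω : BondConfig V}
    (h : ∀ g, timarPop G o n ρ θ ω g ≠ 0) : (openCluster ω o).Infinite := by
  choose c hc using fun g => (timarPop_ne_zero_iff ω g).1 (h g)
  have hmem : ∀ g, c g ∈ openCluster ω o := fun g => (mem_of_timarMass_ne_zero hconn htr hU ω g (hc g)).2.1
  have hinj : Function.Injective c := by
    intro g g' hgg'
    have hs := (mem_of_timarMass_ne_zero hconn htr hU ω g (hc g)).1
    have hs' := (mem_of_timarMass_ne_zero hconn htr hU ω g' (hc g')).1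
    rw [hgg'] at hs
    have := slab_index_unique hconn htr hU hs hs'
    exact Nat.eq_of_mul_eq_mul_right (Nat.succ_pos _) this
  exact Set.infinite_of_injective_forall_mem hinj hmem

end Process

end Literature.Barriers.CriticalPhenomena

end
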